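/-
Copyright (c) 2026 the pub-hodgecm-mathlib formalisation cell (harness21).  Prover seat hodgecm-mathlib-K2Liu-p06 (g2): Track B «K2-LIT»,
#184♮ = hLiu418 = stmt-HodgeConjecture-24832; organ O33.4a for socket #33s `sig_K2LiuZetaSNonvanishingData` of the tier-1 socket module
`Cruxes/HLiu418/Lines/K2_Liu_CurveThetaSigs_U5d_ZetaS.lean` (ED. 3, sha16 7c2f436314d56d7b, :426; LEAD F0P6-plan (g10) RE-DEAL 2026-09-04T02:26:33Z); 2026-09-04.
-/
import Summits.HodgeConjecture.HodgeConjecture.Theorems.K2LiuZetaSInnerProduct          -- ★ organ O33.2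
import HarnessLib

/-!
# Crux `HLiu418`, Track B road `K2_Liu`, unit U5d «`Z_S`», socket #33s — organ O33.4a:
# approximate identities do not annihilate: `∫ f(x) • R(p x) F dν ≠ 0` for a weight `f ≥ 0` concentrated where `Re ⟪F, R(p x) F⟫ > ‖F‖²/2`

Cell `hodgecm-mathlib`, crux item hLiu418 = `stmt-HodgeConjecture-24832`, route of record `HCCMUnconditional`; squad K2 ∕ K2Liu,
LEAD F0P6-plan (g10), planner K2Liu-plan (g2), prover K2Liu-p06 (g2).  THEOREMS ONLY (no `def`, no instance, no notation, no
named-fact hypothesis, no `sorry`, default heartbeats); lane `--supports stmt-HodgeConjecture-24832` (count-neutral helper).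

WHAT IS PROVED (any `𝒢 : AdelicGroupData K`, invariant measure `μ` on `[G]`, `R = rightRegular μ`, `F ∈ L²([G])`, a measure space `(X, ν)`, `p : X → G(𝔸)`):
with the «good set» `U_F := {x | ‖F‖²/2 < Re ⟪F, R(p x) F⟫}`,
* `isOpen_setOf_lt_re_inner_rightRegular` — `U_F` is open when `p` is continuous (★ strong continuity of `R`);
* `mem_setOf_lt_re_inner_rightRegular` — every `x` with `p x = 1` lies in `U_F` as soon as `F ≠ 0`;
* `re_inner_integral_smul_rightRegular_eq` — `Re ⟪F, ∫ f(x) • R(p x) F dν⟫ = ∫ f(x) Re ⟪F, R(p x) F⟫ dν` for a REAL weight `f` (Mathlib `integral_inner`, `integral_re`);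
* `le_re_inner_integral_smul_rightRegular` — **`(‖F‖²/2) ∫ f dν ≤ Re ⟪F, ∫ f(x) • R(p x) F dν⟫`** for `f ≥ 0` supported in `U_F`;
* `norm_integral_smul_rightRegular_ge` — hence `(‖F‖/2) ∫ f dν ≤ ‖∫ f(x) • R(p x) F dν‖`;
* `integral_smul_rightRegular_ne_zero_of_support_subset` — **approximate identities do not annihilate**: `f ≥ 0`, `supp f ⊆ U_F`, `∫ f > 0` ⇒
  `∫ f(x) • R(p x) F dν ≠ 0`;
* `ne_zero_of_norm_sub_lt` ∕ `integral_smul_rightRegular_ne_zero_of_norm_sub_lt` — **robust under `L¹`-small perturbation of the weight**: if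
  `‖f' − f‖_{L¹} ‖F‖ < (‖F‖/2) ∫ f` then also `∫ f'(x) • R(p x) F dν ≠ 0` (★ `norm_integral_smul_rightRegular_le` of O33.3 is the companion bound).
This is step (4)∕O33.4a of the #33s road (tree docstring of `sig_K2LiuZetaSNonvanishingData`, PROOF ROAD (4): «`T_φ φ₁ → φ₁ ≠ 0` by ★ strong continuity»):
once a section `φ♭` has doubling weight `f_{φ♭} ≥ 0` supported in `U_{[φ₁]}` with positive mass (big-cell sections, O33.4b), `T_{f_{φ♭}}[φ₁] ≠ 0`, and the
`𝒦`-finite smear `φ` of `φ♭` (O33.5) keeps `T_{f_φ}[φ₁] ≠ 0` by the perturbation clause.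

HONEST LABEL.  Count-neutral scaffold file of the K2_Liu road; it pays nothing by itself: `HC_CM` is proved only modulo the 7 printed citations
(2 remaining named inputs: hLiu418 = `stmt-HodgeConjecture-24832`, h413 = `stmt-HodgeConjecture-24833`) until rung 0 closes.

## References
* [BorelJacquet1979] A. Borel, H. Jacquet, PSPM 33.1 (1979): §4.6 (strong continuity and unitarity of `R`).
* [Folland1995] G. B. Folland, *A Course in Abstract Harmonic Analysis* (1995): §3.2 (approximate identities in unitary representations).
* [Liu2011] Y. Liu, Algebra Number Theory 5 (2011): §2C (2-5) pp. 863–864 (non-vanishing of the doubling zeta integral on good sections).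
-/

set_option autoImplicit false
set_option linter.dupNamespace false

noncomputable section

open scoped InnerProductSpace
open MeasureTheory Filter Topology

namespace Summit.HodgeConjecture.HodgeConjecture.Cruxes.HLiu418.K2LiuZetaSApproximateIdentity

open Literature.NumberTheory.Automorphic

variable {K : Type} [Field K] [NumberField K] (𝒢 : AdelicGroupData.{0} K) (μ : Measure 𝒢.automorphicQuotient)
  {X : Type*}

/-- The good set `{x | ‖F‖²/2 < Re ⟪F, R(p x) F⟫}` is open for a continuous `p` (★ `isStronglyContinuous_rightRegular_holds`). [cite: BorelJacquet1979, §4.6] -/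
theorem isOpen_setOf_lt_re_inner_rightRegular [𝒢.IsAutomorphicMeasure μ] [TopologicalSpace X] {p : X → 𝒢.Adelic}
    (hp : Continuous p) (F : 𝒢.L2 μ) :
    IsOpen {x : X | ‖F‖ ^ 2 / 2 < RCLike.re ⟪F, 𝒢.rightRegular μ (p x) F⟫_ℂ} :=
  isOpen_lt continuous_const
    (RCLike.continuous_re.comp (continuous_const.inner (((𝒢.isStronglyContinuous_rightRegular_holds μ) F).comp hp)))

variable [SMulInvariantMeasure 𝒢.Adelic 𝒢.automorphicQuotient μ]

/-- A point `x` with `p x = 1` lies in the good set of every `F ≠ 0` (`Re ⟪F, F⟫ = ‖F‖² > ‖F‖²/2`). [cite: BorelJacquet1979, §4.6] -/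
theorem mem_setOf_lt_re_inner_rightRegular {p : X → 𝒢.Adelic} {x : X} (hx : p x = 1) {F : 𝒢.L2 μ} (hF : F ≠ 0) :
    x ∈ {x : X | ‖F‖ ^ 2 / 2 < RCLike.re ⟪F, 𝒢.rightRegular μ (p x) F⟫_ℂ} := by
  have hn : 0 < ‖F‖ := norm_pos_iff.2 hF
  change ‖F‖ ^ 2 / 2 < RCLike.re ⟪F, 𝒢.rightRegular μ (p x) F⟫_ℂ
  rw [hx, map_one, one_apply_eq_self, inner_self_eq_norm_sq_to_K]
  norm_cast
  nlinarith

variable [MeasurableSpace X]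

/-- `Re ⟪F, ∫ f(x) • R(p x) F dν⟫ = ∫ f(x) · Re ⟪F, R(p x) F⟫ dν` for a real weight `f` with Bochner-integrable vector integrand.
[cite: Folland1995, §3.2] -/
theorem re_inner_integral_smul_rightRegular_eq (ν : Measure X) (p : X → 𝒢.Adelic) (f : X → ℝ) (F : 𝒢.L2 μ)
    (hint : Integrable (fun x => (f x : ℂ) • 𝒢.rightRegular μ (p x) F) ν) :
    RCLike.re ⟪F, ∫ x, (f x : ℂ) • 𝒢.rightRegular μ (p x) F ∂ν⟫_ℂ =
      ∫ x, f x * RCLike.re ⟪F, 𝒢.rightRegular μ (p x) F⟫_ℂ ∂ν := by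
  rw [← integral_inner hint, ← integral_re (hint.const_inner F)]
  refine integral_congr_ae (Eventually.of_forall fun x => ?_)
  change RCLike.re ⟪F, (f x : ℂ) • 𝒢.rightRegular μ (p x) F⟫_ℂ = f x * RCLike.re ⟪F, 𝒢.rightRegular μ (p x) F⟫_ℂ
  rw [inner_smul_right]
  exact RCLike.re_ofReal_mul (K := ℂ) (f x) _

/-- **Lower bound.** For a weight `f ≥ 0` supported in the good set of `F`, `(‖F‖²/2) ∫ f dν ≤ Re ⟪F, ∫ f(x) • R(p x) F dν⟫`.
[cite: Folland1995, §3.2] [cite: Liu2011, §2C (2-5) pp. 863–864] -/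
theorem le_re_inner_integral_smul_rightRegular (ν : Measure X) (p : X → 𝒢.Adelic) {f : X → ℝ} (hf : Integrable f ν) (hf0 : 0 ≤ f)
    (F : 𝒢.L2 μ) (hsupp : Function.support f ⊆ {x : X | ‖F‖ ^ 2 / 2 < RCLike.re ⟪F, 𝒢.rightRegular μ (p x) F⟫_ℂ})
    (hint : Integrable (fun x => (f x : ℂ) • 𝒢.rightRegular μ (p x) F) ν) :
    ‖F‖ ^ 2 / 2 * ∫ x, f x ∂ν ≤ RCLike.re ⟪F, ∫ x, (f x : ℂ) • 𝒢.rightRegular μ (p x) F ∂ν⟫_ℂ := by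
  rw [re_inner_integral_smul_rightRegular_eq 𝒢 μ ν p f F hint, ← integral_const_mul]
  have hlow : ∀ x, ‖F‖ ^ 2 / 2 * f x ≤ f x * RCLike.re ⟪F, 𝒢.rightRegular μ (p x) F⟫_ℂ := by
    intro x
    by_cases hx : f x = 0
    · rw [hx, mul_zero, zero_mul]
    · rw [mul_comm]
      exact mul_le_mul_of_nonneg_left (le_of_lt (hsupp (Function.mem_support.2 hx))) (hf0 x)
  have hre : Integrable (fun x => f x * RCLike.re ⟪F, 𝒢.rightRegular μ (p x) F⟫_ℂ) ν := by
    have h := (hint.const_inner (𝕜 := ℂ) F).re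
    refine h.congr (Eventually.of_forall fun x => ?_)
    change RCLike.re ⟪F, (f x : ℂ) • 𝒢.rightRegular μ (p x) F⟫_ℂ = f x * RCLike.re ⟪F, 𝒢.rightRegular μ (p x) F⟫_ℂ
    rw [inner_smul_right]
    exact RCLike.re_ofReal_mul (K := ℂ) (f x) _
  exact integral_mono (hf.const_mul _) hre hlow

/-- Hence `(‖F‖/2) ∫ f dν ≤ ‖∫ f(x) • R(p x) F dν‖` (Cauchy–Schwarz `Re ⟪F, v⟫ ≤ ‖F‖ ‖v‖`). [cite: Folland1995, §3.2] -/
theorem norm_integral_smul_rightRegular_ge (ν : Measure X) (p : X → 𝒢.Adelic) {f : X → ℝ} (hf : Integrable f ν) (hf0 : 0 ≤ f)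
    (F : 𝒢.L2 μ) (hsupp : Function.support f ⊆ {x : X | ‖F‖ ^ 2 / 2 < RCLike.re ⟪F, 𝒢.rightRegular μ (p x) F⟫_ℂ})
    (hint : Integrable (fun x => (f x : ℂ) • 𝒢.rightRegular μ (p x) F) ν) :
    ‖F‖ / 2 * ∫ x, f x ∂ν ≤ ‖∫ x, (f x : ℂ) • 𝒢.rightRegular μ (p x) F ∂ν‖ := by
  have h1 := le_re_inner_integral_smul_rightRegular 𝒢 μ ν p hf hf0 F hsupp hint
  have h2 : RCLike.re ⟪F, ∫ x, (f x : ℂ) • 𝒢.rightRegular μ (p x) F ∂ν⟫_ℂ ≤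
      ‖F‖ * ‖∫ x, (f x : ℂ) • 𝒢.rightRegular μ (p x) F ∂ν‖ := re_inner_le_norm (𝕜 := ℂ) _ _
  have hI : 0 ≤ ∫ x, f x ∂ν := integral_nonneg hf0
  by_cases hF : F = 0
  · rw [hF, norm_zero, zero_div, zero_mul]; exact norm_nonneg _
  · have hn : 0 < ‖F‖ := norm_pos_iff.2 hF
    have h3 : ‖F‖ * (‖F‖ / 2 * ∫ x, f x ∂ν) ≤ ‖F‖ * ‖∫ x, (f x : ℂ) • 𝒢.rightRegular μ (p x) F ∂ν‖ := by
      have : ‖F‖ * (‖F‖ / 2 * ∫ x, f x ∂ν) = ‖F‖ ^ 2 / 2 * ∫ x, f x ∂ν := by ring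
      rw [this]; exact h1.trans h2
    exact le_of_mul_le_mul_left h3 hn

/-- **Approximate identities do not annihilate.** If `f ≥ 0` is supported in the good set of `F` and has positive mass, then
`∫ f(x) • R(p x) F dν ≠ 0`. [cite: Folland1995, §3.2] [cite: Liu2011, §2C (2-5) pp. 863–864] -/
theorem integral_smul_rightRegular_ne_zero_of_support_subset (ν : Measure X) (p : X → 𝒢.Adelic) {f : X → ℝ} (hf : Integrable f ν)
    (hf0 : 0 ≤ f) (hpos : 0 < ∫ x, f x ∂ν) {F : 𝒢.L2 μ} (hF : F ≠ 0)
    (hsupp : Function.support f ⊆ {x : X | ‖F‖ ^ 2 / 2 < RCLike.re ⟪F, 𝒢.rightRegular μ (p x) F⟫_ℂ})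
    (hint : Integrable (fun x => (f x : ℂ) • 𝒢.rightRegular μ (p x) F) ν) :
    (∫ x, (f x : ℂ) • 𝒢.rightRegular μ (p x) F ∂ν) ≠ 0 := by
  intro h0
  have h := norm_integral_smul_rightRegular_ge 𝒢 μ ν p hf hf0 F hsupp hint
  rw [h0, norm_zero] at h
  have hn : 0 < ‖F‖ := norm_pos_iff.2 hF
  nlinarith

omit [SMulInvariantMeasure 𝒢.Adelic 𝒢.automorphicQuotient μ] in
/-- A vector within distance `< ‖v‖` of a vector `v` is non-zero. [folklore] -/
theorem ne_zero_of_norm_sub_lt {E : Type*} [NormedAddCommGroup E] {v w : E} (h : ‖w - v‖ < ‖v‖) : w ≠ 0 := by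
  rintro rfl
  rw [zero_sub, norm_neg] at h
  exact lt_irrefl _ h

/-- **Robustness under `L¹`-perturbation of the weight.** With `f` as in `integral_smul_rightRegular_ne_zero_of_support_subset` and a second
(complex) weight `f'` whose vector integrand is integrable and `L¹`-close: `(∫ ‖f' − f‖ dν) ‖F‖ < (‖F‖/2) ∫ f dν`, also `∫ f'(x) • R(p x) F dν ≠ 0`
(`‖T_{f'} F − T_f F‖ ≤ ‖f' − f‖_{L¹} ‖F‖`, `R` isometric). [cite: Folland1995, §3.2] [cite: Liu2011, §2C (2-5) pp. 863–864] -/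
theorem integral_smul_rightRegular_ne_zero_of_norm_sub_lt (ν : Measure X) (p : X → 𝒢.Adelic) {f : X → ℝ} (hf : Integrable f ν)
    (hf0 : 0 ≤ f) {F : 𝒢.L2 μ}
    (hsupp : Function.support f ⊆ {x : X | ‖F‖ ^ 2 / 2 < RCLike.re ⟪F, 𝒢.rightRegular μ (p x) F⟫_ℂ})
    (hint : Integrable (fun x => (f x : ℂ) • 𝒢.rightRegular μ (p x) F) ν)
    {f' : X → ℂ} (hint' : Integrable (fun x => f' x • 𝒢.rightRegular μ (p x) F) ν)
    (hclose : (∫ x, ‖f' x - (f x : ℂ)‖ ∂ν) * ‖F‖ < ‖F‖ / 2 * ∫ x, f x ∂ν) :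
    (∫ x, f' x • 𝒢.rightRegular μ (p x) F ∂ν) ≠ 0 := by
  refine ne_zero_of_norm_sub_lt (v := ∫ x, (f x : ℂ) • 𝒢.rightRegular μ (p x) F ∂ν) ?_
  rw [← integral_sub hint' hint]
  have hb : ‖∫ x, (f' x • 𝒢.rightRegular μ (p x) F - (f x : ℂ) • 𝒢.rightRegular μ (p x) F) ∂ν‖ ≤
      (∫ x, ‖f' x - (f x : ℂ)‖ ∂ν) * ‖F‖ := by
    calc ‖∫ x, (f' x • 𝒢.rightRegular μ (p x) F - (f x : ℂ) • 𝒢.rightRegular μ (p x) F) ∂ν‖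
        ≤ ∫ x, ‖f' x • 𝒢.rightRegular μ (p x) F - (f x : ℂ) • 𝒢.rightRegular μ (p x) F‖ ∂ν := norm_integral_le_integral_norm _
      _ = ∫ x, ‖f' x - (f x : ℂ)‖ * ‖F‖ ∂ν := by
          refine integral_congr_ae (Eventually.of_forall fun x => ?_)
          change ‖f' x • 𝒢.rightRegular μ (p x) F - (f x : ℂ) • 𝒢.rightRegular μ (p x) F‖ = ‖f' x - (f x : ℂ)‖ * ‖F‖
          rw [← sub_smul, norm_smul, 𝒢.norm_rightRegular_apply μ]
      _ = (∫ x, ‖f' x - (f x : ℂ)‖ ∂ν) * ‖F‖ := integral_mul_const _ _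
  exact lt_of_le_of_lt hb (hclose.trans_le (norm_integral_smul_rightRegular_ge 𝒢 μ ν p hf hf0 F hsupp hint))

end Summit.HodgeConjecture.HodgeConjecture.Cruxes.HLiu418.K2LiuZetaSApproximateIdentity

end
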